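import Summits.QuantumFields.YangMills.Theorems.BalabanUVNodesN15CovariantSandwichObjects
import Summits.QuantumFields.YangMills.Theorems.BalabanUVNodesN15GenericSandwichLetters
import Summits.QuantumFields.YangMills.Theorems.BalabanUVNodesN15TwoSpacingGluingCurvedKnitSmallFieldDefect
import HarnessLib

/-!
# N15 = NE2 — PROGRAMME Q «COVARIANT AVERAGE IN THE SANDWICH», part (Q-2b): ★★★ THE THREE LETTERS OF THE COVARIANTLY AVERAGED LIVE BACKGROUND MATRICES `zCovC`, `zCovF` from the DISPLAYED
# rows of the averaging perturbations `D, E` (sizes `ρ_D, ρ_E`, two-grid defects `τ_D, τ_E`) — Σ-col (H)'s three hypotheses for the middle factor with the averaging `Q⊗1 + D`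
# (dag-n15-a g31, FILE (Q-2b); node N15 = NE2; `--kind proof --supports stmt-QuantumFields-27366 --as helper`, count-neutral; theorems only, 0 def; imports (Q-2a), (Q-1), n15-c FILE 130)

WHY ∕ HOW.  `Q_U X Q_U† − (Q⊗1)(G⊗1)(Q*⊗1) = (Q⊗1)(X − G⊗1)(Q*⊗1) + D∘X∘Q_U† + (Q⊗1)∘X∘E` (`Q_U = Q⊗1 + D`, `Q_U† = Q*⊗1 + E`; (Q-2a) `zCovC_eq`): the first summand is (J-b′)'s `zLive`
(letters `exists_zLive_letters`), the other two are sandwiches of dag-n15-c's live glued propagator `X` (rows: FILE 133 `sf_cvGlued_pair_spec` decay, FILE 130 `sf_idef_cvGlued` η-defect) by `D`,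
`Q_U†` resp. `Q⊗1`, `E` (rows: (J-a) `hasMaj_tensorId_qvRe∕AdjRe`, part 45 `hasMaj_qvAdjRe_sub_pull_comp`, FILE 99 `hasMaj_qvRe_pull_sub_comp_of_line`, and the DISPLAYED rows of `D, E, D′, E′`) —
(Q-1) `hasMaj_sandwich_exp_ofBlocks` ∕ `hasMaj_sandwich_sub_exp_ofBlocks` twice each, (J-a) §2 `abs_unitBondMatC_le_of_hasMaj`, the scalar budgets of (Q-2a) §2a.

WHAT.  ★★★ `exists_zCov_letters`: `∃ ρ δ w₀ R₀ K > 0` (from `d, L, a, ι`; `ρ` = the rate at which the perturbation rows are read), in FILE 133's regime, for ALL `D, E, D′, E′` with six DISPLAYED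
block-majorant rows at rate `ρ` (sizes `ρ_D, ρ_E ≤ 1` at both spacings; comparison rows `D′∘P − D` (`τ_D`), `E′ − P∘E` (`τ_E`) along King's pairing ⊗ 1_ι): (i)(ii) `|zCov(p,q)| ≤ K(κ_e r_A + ρ_D +
ρ_E)e^{−δ·cdist}`, (iii) `|zCovF − zCovC| ≤ K((L^k)^{−1∕16} + κ_e r_A (L^k)⁻¹ + τ_D + τ_E)e^{−δ·cdist}` — Σ-col (H) `exDress_deltaCol_letters`' hypotheses with `ζ = K(κ_e r_A + ρ_D + ρ_E)`,
`τ = K((L^k)^{−1∕16} + κ_e r_A (L^k)⁻¹ + τ_D + τ_E)`; at `D = E = D′ = E′ = 0` these are (J-b′)'s three letters.  In print `ρ_D = O(1)·α₁` ([B9] (3.81)) — proportional to the field letter.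

HONEST FRAMING ∕ LIMITS.  Block-majorant bookkeeping over landed rows; the covariant averaging MODELLED as `Q⊗1 + D` with `D`'s letters DISPLAYED ((3.81)'s shape) — [5] (124) NOT typed, the
object is n15-c∕181's; MODEL objects of n15-c FILE 130∕133; no layer of NE2 proved here; NOT [B9] Thms 3.1∕3.2∕3.15 AS PRINTED; N15 stays DISCHARGED OF RECORD AS CONSUMED (U-blind v7 pin,
p687738), nothing re-claimed, no count moved; K3⁸ OPEN; finite 𝕋⁴ per index — NOT ℝ⁴ ∕ OS ∕ mass gap ∕ Clay.  `set_option maxHeartbeats 800000 in` ×1 ((J-b)'s budget) + `maxRecDepth 8192 in` ×1.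
LEAN NOTE (successor): `set M := …` re-introduces DATA binders whose types mention the term as inaccessible — introduce `D E D′ E′` AFTER `set`; `linarith`∕`nlinarith` must not run with the
huge entry inequalities in context (`clear` them; scalar budgets in (Q-2a) §2a).  No `sorry`, `def`, `instance`, `notation`; standard axioms.
[cite: Balaban1985BackgroundPropagators, Thm 3.2 (3.48) p.398, (3.78)–(3.81) p.406, Thm 3.1 (3.42) p.397 + (3.62)–(3.65) pp.402–403 (η-rate: shape); Balaban1984PropagatorsI, (1.18) p.20, (1.102)–(1.103) p.34; Balaban1984PropagatorsII,
(2.52)–(2.56) pp.232–233, Lemma 2.1 (2.61) p.234; King1986, p.664 (the pairing), Prop. 3.9 (3.73) p.665 (η-rate shape)]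
-/

open scoped BigOperators Matrix Matrix.Norms.Frobenius

namespace Summit.QuantumFields.YangMills.BalabanUVNodes.N15.GluedZeroField

open Literature.MathematicalPhysics.QuantumFieldTheory.Balaban1983to89
open Literature.MathematicalPhysics.QuantumFieldTheory.King1986 (exp_decay_mono)
open Literature.MathematicalPhysics.QuantumFieldTheory.Balaban1983to89.B5Prop11Plancherel (Tor fine)
open Literature.MathematicalPhysics.QuantumFieldTheory.Balaban1983to89.B6Lemma24Torus (pbox)
open Literature.MathematicalPhysics.QuantumFieldTheory.Balaban1983to89.B6RandomWalk (Triangle254)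
open Literature.MathematicalPhysics.QuantumFieldTheory.Balaban1983to89.B11SectG (BlockNorm HasMaj RowSum hasMaj_comp_exp)
open Literature.MathematicalPhysics.QuantumFieldTheory.Balaban1983to89.B9Eq3130MatrixLetters (hasMaj_id_ofBlocks)
open Literature.MathematicalPhysics.QuantumFieldTheory.Balaban1983to89.B6UnitTorusCarrier (unitTorusGeo unitTorusGeo_dist unitTorusGeo_dist_nonneg unitTorusGeo_dist_self triangle254_unitTorusGeo rowSum_unitTorusGeo)
open Literature.MathematicalPhysics.QuantumFieldTheory.Balaban1983to89.T4EtaRateDefect (idef)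
open Literature.MathematicalPhysics.QuantumFieldTheory.Balaban1983to89.T4EtaRateCoeffDefect (pull)
open Literature.MathematicalPhysics.QuantumFieldTheory.King1986.Torus (blockOf tdistT)
open Literature.Barriers.QuantumFields (traceForm)
open Summit.QuantumFields.YangMills.BalabanUVNodes.N15.BackgroundLayer (gavgM tensorId_sub tensorId_comp_tensorId)
open Summit.QuantumFields.YangMills.BalabanUVNodes.N15.BackgroundModel (kappa_ofBlocks)
open Summit.QuantumFields.YangMills.BalabanUVNodes.N15.SiteLayer (hasMaj_exp_mono hasMaj_add_exp)
open Summit.QuantumFields.YangMills.BalabanUVNodes.N15.VectorPiece (bshiftEquiv kingPrV blkFine tensorId tensorId_apply hasMaj_tensorId blkFine_comp_kingPrV)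
open Summit.QuantumFields.YangMills.BalabanUVNodes.N15.MatrixSpecies (basisConst basisConst_nonneg liftBlk liftMap)
open Summit.QuantumFields.YangMills.BalabanUVNodes.N15.TwoGrid (gOp qvRe qvAdjRe symbOp sD sA hasMaj_qvAdjRe_sub_pull_comp)
open Summit.QuantumFields.YangMills.BalabanUVNodes.N15.UnitLayerBgCol (unitBondMatC unitBondMatC_add unitBondMatC_sub unitBondMatC_zero cdist cdist_nonneg)
open Summit.QuantumFields.YangMills.BalabanUVNodes.N15.Gluing (cvM CvX CvX' cvBlk CvNorm cvNL cvNL' cvGlued cvGlued' hasMaj_lineDiff_comp hasMaj_qvRe_pull_sub_comp_of_line sf_cvGlued_pair_spec sf_idef_cvGlued)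

variable (d : ℕ) {L : ℕ} [NeZero L] (mm ι : Type) [Fintype mm] [DecidableEq mm] [Fintype ι] [DecidableEq ι] (a : ℝ) (e : Matrix mm mm ℂ ≃L[ℝ] (ι → ℝ))

/-! ## §2 ★★★ The three letters of the covariantly averaged matrices from the displayed rows of the averaging perturbations -/

set_option maxHeartbeats 800000 in
set_option maxRecDepth 8192 in
/-- ★★★ **THE THREE LETTERS OF THE COVARIANTLY AVERAGED LIVE BACKGROUND MATRICES.**  `L ≥ 7` odd, `a > 0`, `ι` nonempty, trace-form-orthonormal `e`.  There are `ρ, δ, w₀, R₀, K > 0` (from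
`d, L, a, ι` only; `ρ` = the rate at which the perturbation rows are read) such that in FILE 133's regime (`k ≥ 1`, `L^m ≥ w₀`, skew-Hermitian fine potential `A′` in the C² window at scale
`r_A`, `2(2+d)(5+2d)r_A ≤ 1`, scale `≤ R₀`), for ALL averaging perturbations `D, E` (coarse) and `D′, E′` (fine) with the six DISPLAYED block-majorant rows at rate `ρ` on the cover's unit torus —
sizes `|D|, |D′| ≤ ρ_D·e^{−ρd}`, `|E|, |E′| ≤ ρ_E·e^{−ρd}` (`0 ≤ ρ_D, ρ_E ≤ 1`) and the two-grid comparison rows along King's pairing `P` (⊗ 1_ι): `D′∘P − D ≤ τ_D·e^{−ρd}`, `E′ − P∘E ≤ τ_E·e^{−ρd}`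
— the matrices `Z_cov = zCovC A′ D E`, `Z′_cov = zCovF A′ D′ E′` satisfy (i) `|Z_cov(p,q)| ≤ K·(κ_e·r_A + ρ_D + ρ_E)·e^{−δ·cdist(p,q)}`, (ii) the same for `Z′_cov`, (iii)
`|Z′_cov(p,q) − Z_cov(p,q)| ≤ K·((L^k)^{−1∕16} + κ_e·r_A·(L^k)⁻¹ + τ_D + τ_E)·e^{−δ·cdist(p,q)}` — Σ-col (H) `exDress_deltaCol_letters`' three hypotheses with `ζ = K(κ_e r_A + ρ_D + ρ_E)`,
`τ = K((L^k)^{−1∕16} + κ_e r_A (L^k)⁻¹ + τ_D + τ_E)`.  At `D = E = D′ = E′ = 0` (all rows trivially met with `ρ_D = ρ_E = τ_D = τ_E = 0`) these are (J-b′)'s three letters (`zCovC_zero_zero`).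
In print `ρ_D = O(1)·α₁` ([B9] (3.81)) — proportional to the field letter — so `ζ` is small in the (3.35) window, as (H) requires.
[cite: Balaban1985BackgroundPropagators, Thm 3.2 (3.48) p.398, (3.78)–(3.81) p.406, Thm 3.1 (3.42) p.397 (η-rate shape), (3.62)–(3.65) pp.402–403; Balaban1984PropagatorsI, (1.18) p.20, (1.102)–(1.103) p.34; Balaban1984PropagatorsII,
(2.52)–(2.56) pp.232–233, Lemma 2.1 (2.61) p.234; King1986, p.664, Prop. 3.9 (3.73) p.665] -/
theorem exists_zCov_letters (hL : Odd L ∧ 1 < L) (hL7 : 7 ≤ L) (ha : 0 < a) [Nonempty ι] :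
    ∃ ρ δ w₀ R₀ K : ℝ, 0 < ρ ∧ 0 < δ ∧ 0 < R₀ ∧ 0 < K ∧
      ∀ (mv kk r : ℕ), 1 ≤ kk → w₀ ≤ ((L ^ mv : ℕ) : ℝ) →
      (∀ A B : Matrix mm mm ℂ, traceForm A B = e A ⬝ᵥ e B) →
      ∀ (A' : Fin (d + 1) → CvX' d L mv kk r hL → Matrix mm mm ℂ), (∀ μ x', (A' μ x')ᴴ = -A' μ x') →
      ∀ (rA : ℝ), 0 ≤ rA → (∀ μ x', ‖A' μ x'‖ ≤ rA) →
        (∀ μ κ x', ‖A' μ (bshiftEquiv (cvM d L mv kk hL) (L ^ r * L ^ kk) κ x') - A' μ x'‖ ≤ rA * ((((L ^ r * L ^ kk : ℕ) : ℝ))⁻¹)) →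
        (∀ μ κ x', ‖(A' μ (bshiftEquiv (cvM d L mv kk hL) (L ^ r * L ^ kk) κ x') - A' μ x') -
            (A' μ (bshiftEquiv (cvM d L mv kk hL) (L ^ r * L ^ kk) κ ((bshiftEquiv (cvM d L mv kk hL) (L ^ r * L ^ kk) μ).symm x')) -
              A' μ ((bshiftEquiv (cvM d L mv kk hL) (L ^ r * L ^ kk) μ).symm x'))‖ ≤ rA * ((((L ^ r * L ^ kk : ℕ) : ℝ))⁻¹) * ((((L ^ r * L ^ kk : ℕ) : ℝ))⁻¹)) →
        2 * ((1 + Fintype.card (Fin (d + 1))) * ((3 + 2 * ((d : ℝ) + 1)) * rA)) ≤ 1 →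
        (14 * Real.exp 1 * (1 + Fintype.card (Fin (d + 1))) * basisConst e * ((1 + Fintype.card (Fin (d + 1))) * ((3 + 2 * ((d : ℝ) + 1)) * rA))) * (1 + Fintype.card (Fin (d + 1) ⊕ Fin (d + 1))) ≤ R₀ →
      ∀ (D : (CvX d L mv kk hL × ι → ℝ) →ₗ[ℝ] ((Tor (cvM d L mv kk hL) × Fin (d + 1)) × ι → ℝ))
        (E : ((Tor (cvM d L mv kk hL) × Fin (d + 1)) × ι → ℝ) →ₗ[ℝ] (CvX d L mv kk hL × ι → ℝ))
        (D' : (CvX' d L mv kk r hL × ι → ℝ) →ₗ[ℝ] ((Tor (cvM d L mv kk hL) × Fin (d + 1)) × ι → ℝ))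
        (E' : ((Tor (cvM d L mv kk hL) × Fin (d + 1)) × ι → ℝ) →ₗ[ℝ] (CvX' d L mv kk r hL × ι → ℝ))
        (ρD ρE τD τE : ℝ), 0 ≤ ρD → ρD ≤ 1 → 0 ≤ ρE → ρE ≤ 1 → 0 ≤ τD → 0 ≤ τE →
        HasMaj (CvNorm d L mv kk hL ι) (BlockNorm.ofBlocks (unitTorusGeo L kk (cvM d L mv kk hL)) (liftBlk (fun b : Tor (cvM d L mv kk hL) × Fin (d + 1) => b.1) ι)) D
          (fun y y' => ρD * Real.exp (-(ρ * (unitTorusGeo L kk (cvM d L mv kk hL)).dist y y'))) →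
        HasMaj (BlockNorm.ofBlocks (unitTorusGeo L kk (cvM d L mv kk hL)) (liftBlk (fun b : CvX' d L mv kk r hL => blockOf (L ^ r * L ^ kk) (cvM d L mv kk hL) b.1) ι))
          (BlockNorm.ofBlocks (unitTorusGeo L kk (cvM d L mv kk hL)) (liftBlk (fun b : Tor (cvM d L mv kk hL) × Fin (d + 1) => b.1) ι)) D'
          (fun y y' => ρD * Real.exp (-(ρ * (unitTorusGeo L kk (cvM d L mv kk hL)).dist y y'))) →
        HasMaj (BlockNorm.ofBlocks (unitTorusGeo L kk (cvM d L mv kk hL)) (liftBlk (fun b : Tor (cvM d L mv kk hL) × Fin (d + 1) => b.1) ι)) (CvNorm d L mv kk hL ι) E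
          (fun y y' => ρE * Real.exp (-(ρ * (unitTorusGeo L kk (cvM d L mv kk hL)).dist y y'))) →
        HasMaj (BlockNorm.ofBlocks (unitTorusGeo L kk (cvM d L mv kk hL)) (liftBlk (fun b : Tor (cvM d L mv kk hL) × Fin (d + 1) => b.1) ι))
          (BlockNorm.ofBlocks (unitTorusGeo L kk (cvM d L mv kk hL)) (liftBlk (fun b : CvX' d L mv kk r hL => blockOf (L ^ r * L ^ kk) (cvM d L mv kk hL) b.1) ι)) E'
          (fun y y' => ρE * Real.exp (-(ρ * (unitTorusGeo L kk (cvM d L mv kk hL)).dist y y'))) →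
        HasMaj (CvNorm d L mv kk hL ι) (BlockNorm.ofBlocks (unitTorusGeo L kk (cvM d L mv kk hL)) (liftBlk (fun b : Tor (cvM d L mv kk hL) × Fin (d + 1) => b.1) ι))
          (D' ∘ₗ pull (liftMap (kingPrV L kk r (cvM d L mv kk hL)) ι) - D)
          (fun y y' => τD * Real.exp (-(ρ * (unitTorusGeo L kk (cvM d L mv kk hL)).dist y y'))) →
        HasMaj (BlockNorm.ofBlocks (unitTorusGeo L kk (cvM d L mv kk hL)) (liftBlk (fun b : Tor (cvM d L mv kk hL) × Fin (d + 1) => b.1) ι))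
          (BlockNorm.ofBlocks (unitTorusGeo L kk (cvM d L mv kk hL)) (liftBlk (fun b : CvX' d L mv kk r hL => blockOf (L ^ r * L ^ kk) (cvM d L mv kk hL) b.1) ι))
          (E' - pull (liftMap (kingPrV L kk r (cvM d L mv kk hL)) ι) ∘ₗ E)
          (fun y y' => τE * Real.exp (-(ρ * (unitTorusGeo L kk (cvM d L mv kk hL)).dist y y'))) →
        (∀ p q, |zCovC d mm ι a e hL mv kk r A' D E p q| ≤ K * (basisConst e * rA + ρD + ρE) * Real.exp (-(δ * cdist (cvM d L mv kk hL) ι p q))) ∧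
        (∀ p q, |zCovF d mm ι a e hL mv kk r A' D' E' p q| ≤ K * (basisConst e * rA + ρD + ρE) * Real.exp (-(δ * cdist (cvM d L mv kk hL) ι p q))) ∧
        (∀ p q, |zCovF d mm ι a e hL mv kk r A' D' E' p q - zCovC d mm ι a e hL mv kk r A' D E p q|
          ≤ K * ((((L ^ kk : ℕ) : ℝ)) ^ (-(1 / 16 : ℝ)) + basisConst e * rA * ((((L ^ kk : ℕ) : ℝ))⁻¹) + τD + τE) * Real.exp (-(δ * cdist (cvM d L mv kk hL) ι p q))) := by
  have hLpos : 0 < L := Nat.pos_of_ne_zero (NeZero.ne L)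
  -- the three inputs: (J-b′)'s letters of `zLive`, FILE 133's decay of `X, X′`, FILE 130's η-defect of `(X′, X)`
  obtain ⟨δZ, wZ, RZ, KZ, hδZ, hRZ, hKZ, HZ⟩ := exists_zLive_letters d mm ι a e hL hL7 ha
  obtain ⟨δX, wX, RX, BX, hδX, hRX, hBX, HX⟩ := sf_cvGlued_pair_spec (d := d) hL hL7 ha ι
  obtain ⟨δI, wI, RI, DI, hδI, hRI, HI⟩ := sf_idef_cvGlued (d := d) hL hL7 ha ι
  -- the base rate `ρ₀ ≤ δ_X, δ_I∕16`; row sums at `ρ₀∕2`, `ρ₀∕4`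
  obtain ⟨ρ₀, hρ₀def⟩ : ∃ ρ₀ : ℝ, ρ₀ = min δX (δI / 16) := ⟨_, rfl⟩
  have hρ₀ : 0 < ρ₀ := by rw [hρ₀def]; exact lt_min hδX (by positivity)
  have hρ₀X : ρ₀ ≤ δX := by rw [hρ₀def]; exact min_le_left _ _
  have hρ₀I : ρ₀ ≤ δI / 16 := by rw [hρ₀def]; exact min_le_right _ _
  have hσ₂ : 0 < ρ₀ / 2 := by positivity
  have hσ₄ : 0 < ρ₀ / 4 := by positivity
  set c₂ : ℝ := B4Sect5Proof.latticeConst (d + 1) (ρ₀ / 2) + 1 with hc₂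
  set c₄ : ℝ := B4Sect5Proof.latticeConst (d + 1) (ρ₀ / 4) + 1 with hc₄
  have hc₂0 : 0 < c₂ := by have := B4Sect5Proof.latticeConst_nonneg (d + 1) hσ₂.le; rw [hc₂]; linarith
  have hc₄0 : 0 < c₄ := by have := B4Sect5Proof.latticeConst_nonneg (d + 1) hσ₄.le; rw [hc₄]; linarith
  set R₁ : ℝ := 14 * Real.exp 1 * (1 + Fintype.card (Fin (d + 1))) * ((1 + Fintype.card (Fin (d + 1))) * (3 + 2 * ((d : ℝ) + 1))) * (1 + Fintype.card (Fin (d + 1) ⊕ Fin (d + 1)))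
    with hR₁
  have hR₁0 : 0 < R₁ := by positivity
  have he₀0 : 0 < Real.exp ρ₀ := Real.exp_pos _
  set K : ℝ := KZ + c₂ * c₄ * ((6 * Real.exp ρ₀ + 2) * BX + (2 * Real.exp ρ₀ + 1) * |DI| * (1 + R₁)) + 1 with hK
  have hKpos : 0 < K := by positivity
  refine ⟨ρ₀, min δZ (ρ₀ / 4), max wZ (max wX wI), min RZ (min RX RI), K, hρ₀, lt_min hδZ hσ₄, lt_min hRZ (lt_min hRX hRI), hKpos, fun mv kk r hk hw => ?_⟩
  intro he A' hA' rA hrA h1 h2 h3 hr2 hRle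
  -- the inputs at the index
  obtain ⟨hZ1, hZ2, hZ3⟩ := HZ mv kk r hk ((le_max_left _ _).trans hw) he A' hA' rA hrA h1 h2 h3 hr2 (hRle.trans (min_le_left _ _))
  obtain ⟨⟨hXc, -⟩, hXf, -⟩ := HX mv kk r hk (((le_max_left wX wI).trans (le_max_right wZ _)).trans hw) e he A' hA' rA hrA h1 h2 h3 hr2
    (hRle.trans ((min_le_right _ _).trans (min_le_left _ _)))
  have hXI := HI mv kk r hk (((le_max_right wX wI).trans (le_max_right wZ _)).trans hw) e he A' hA' rA hrA h1 h2 h3 hr2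
    (hRle.trans ((min_le_right _ _).trans (min_le_right _ _)))
  -- FILE 130's codomain blocks `cvBlk ∘ kingPrV` ARE the fine King blocks
  have hbk : cvBlk d L mv kk hL ∘ kingPrV L kk r (cvM d L mv kk hL) = fun i' : CvX' d L mv kk r hL => blockOf (L ^ r * L ^ kk) (cvM d L mv kk hL) i'.1 :=
    blkFine_comp_kingPrV (M := cvM d L mv kk hL) L kk r
  rw [hbk] at hXI
  set M := cvM d L mv kk hL with hM
  intro D E D' E' ρD ρE τD τE hρD hρD1 hρE hρE1 hτD hτE hDc hDf hEc hEf hDd hEd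
  have hκ0 : 0 ≤ basisConst e := basisConst_nonneg e
  have hkpos : (0 : ℝ) < ((L ^ kk : ℕ) : ℝ) := Nat.cast_pos.mpr (pow_pos hLpos kk)
  have hx1 : (1 : ℝ) ≤ ((L ^ kk : ℕ) : ℝ) := by exact_mod_cast Nat.one_le_pow kk L hLpos
  have hθ0 : 0 ≤ (((L ^ kk : ℕ) : ℝ)) ^ (-(1 / 16 : ℝ)) := Real.rpow_nonneg hkpos.le _
  have hη0 : 0 ≤ ((((L ^ kk : ℕ) : ℝ))⁻¹) := inv_nonneg.mpr hkpos.le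
  have hηθ : ((((L ^ kk : ℕ) : ℝ))⁻¹) ≤ (((L ^ kk : ℕ) : ℝ)) ^ (-(1 / 16 : ℝ)) := by
    rw [← Real.rpow_neg_one]; exact Real.rpow_le_rpow_of_exponent_le hx1 (by norm_num)
  have hcast : ((L : ℝ) ^ kk) = (((L ^ kk : ℕ) : ℝ)) := by push_cast; rfl
  have htri := triangle254_unitTorusGeo L kk M
  have hd := fun y y' => unitTorusGeo_dist_nonneg L kk M y y'
  have hrow₂ : RowSum (unitTorusGeo L kk M) (ρ₀ / 2) c₂ := fun y => (rowSum_unitTorusGeo L kk M hσ₂ y).trans (by rw [hc₂]; linarith)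
  have hrow₄ : RowSum (unitTorusGeo L kk M) (ρ₀ / 4) c₄ := fun y => (rowSum_unitTorusGeo L kk M hσ₄ y).trans (by rw [hc₄]; linarith)
  -- FILE 130's constant: `D_I ↦ |D_I|`, rate `δ_I∕16 ↦ ρ₀`
  have hRc : 14 * Real.exp 1 * (1 + Fintype.card (Fin (d + 1))) * basisConst e * ((1 + Fintype.card (Fin (d + 1))) * ((3 + 2 * ((d : ℝ) + 1)) * rA)) *
      (1 + Fintype.card (Fin (d + 1) ⊕ Fin (d + 1))) = R₁ * basisConst e * rA := by rw [hR₁]; ring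
  rw [hRc] at hXI
  have hXI' := hXI.mono (K' := fun y y' => |DI| * ((((L ^ kk : ℕ) : ℝ)) ^ (-(1 / 16 : ℝ)) + R₁ * basisConst e * rA * ((((L ^ kk : ℕ) : ℝ))⁻¹)) *
      Real.exp (-(ρ₀ * (unitTorusGeo L kk M).dist y y'))) fun y y' => by
    have hd0 := unitTorusGeo_dist_nonneg L kk M y y'
    have hs : 0 ≤ (((L ^ kk : ℕ) : ℝ)) ^ (-(1 / 16 : ℝ)) + R₁ * basisConst e * rA * ((((L ^ kk : ℕ) : ℝ))⁻¹) := by positivity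
    calc DI * ((((L ^ kk : ℕ) : ℝ)) ^ (-(1 / 16 : ℝ)) + R₁ * basisConst e * rA * ((((L ^ kk : ℕ) : ℝ))⁻¹)) * Real.exp (-(δI / 16 * (unitTorusGeo L kk M).dist y y'))
        ≤ |DI| * ((((L ^ kk : ℕ) : ℝ)) ^ (-(1 / 16 : ℝ)) + R₁ * basisConst e * rA * ((((L ^ kk : ℕ) : ℝ))⁻¹)) * Real.exp (-(δI / 16 * (unitTorusGeo L kk M).dist y y')) :=
          mul_le_mul_of_nonneg_right (mul_le_mul_of_nonneg_right (le_abs_self DI) hs) (Real.exp_nonneg _)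
      _ ≤ |DI| * ((((L ^ kk : ℕ) : ℝ)) ^ (-(1 / 16 : ℝ)) + R₁ * basisConst e * rA * ((((L ^ kk : ℕ) : ℝ))⁻¹)) * Real.exp (-(ρ₀ * (unitTorusGeo L kk M).dist y y')) :=
          mul_le_mul_of_nonneg_left (Real.exp_le_exp.mpr (by nlinarith)) (mul_nonneg (abs_nonneg DI) hs)
  -- the decay rows of `X, X′` at the base rate
  have hXc₀ := hasMaj_exp_mono hd hBX.le hρ₀X hXc
  have hXf₀ := hasMaj_exp_mono hd hBX.le hρ₀X hXf
  -- the flat averaging rows ⊗ 1_ι at the base rate, and the perturbed ones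
  have hQc := hasMaj_tensorId_qvRe (L := L) M kk (L ^ kk) ι hρ₀.le
  have hQf := hasMaj_tensorId_qvRe (L := L) M kk (L ^ r * L ^ kk) ι hρ₀.le
  have hAc := hasMaj_tensorId_qvAdjRe (L := L) M kk (L ^ kk) ι hρ₀.le
  have hAf := hasMaj_tensorId_qvAdjRe (L := L) M kk (L ^ r * L ^ kk) ι hρ₀.le
  have hAUc := hasMaj_add_exp hAc hEc
  have hAUf := hasMaj_add_exp hAf hEf
  -- the two-grid comparison rows: part 45 (`Q′* − PQ*`) ⊗ 1_ι plus `E′ − PE`; FILE 99 (`Q′P − Q` on rough inputs) ⊗ 1_ι plus `D′P − D`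
  have h45 := hasMaj_qvAdjRe_sub_pull_comp M kk r (B := 1) zero_le_one hρ₀.le
    (hasMaj_id_ofBlocks (g := unitTorusGeo L kk M) (fun b : Tor M × Fin (d + 1) => b.1) (unitTorusGeo_dist_self L kk M) ρ₀)
  rw [LinearMap.comp_id] at h45
  have hb := hasMaj_tensorId ι (fun y y' => by positivity) h45
  rw [tensorId_sub, ← tensorId_comp_tensorId, tensorId_pull] at hb
  have hAUd : HasMaj (BlockNorm.ofBlocks (unitTorusGeo L kk M) (liftBlk (fun b : Tor M × Fin (d + 1) => b.1) ι))
      (BlockNorm.ofBlocks (unitTorusGeo L kk M) (liftBlk (fun b : CvX' d L mv kk r hL => blockOf (L ^ r * L ^ kk) M b.1) ι))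
      ((tensorId ι (qvAdjRe M (L ^ r * L ^ kk)) + E') - pull (liftMap (kingPrV L kk r M) ι) ∘ₗ (tensorId ι (qvAdjRe M (L ^ kk)) + E))
      (fun y y' => (2 * Real.exp ρ₀ / (L : ℝ) ^ kk * 1 + τE) * Real.exp (-(ρ₀ * tdistT M y y'))) := by
    have hsplitA : (tensorId ι (qvAdjRe M (L ^ r * L ^ kk)) + E') - pull (liftMap (kingPrV L kk r M) ι) ∘ₗ (tensorId ι (qvAdjRe M (L ^ kk)) + E) =
        (tensorId ι (qvAdjRe M (L ^ r * L ^ kk)) - pull (liftMap (kingPrV L kk r M) ι) ∘ₗ tensorId ι (qvAdjRe M (L ^ kk))) + (E' - pull (liftMap (kingPrV L kk r M) ι) ∘ₗ E) := by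
      rw [LinearMap.comp_add]; abel
    rw [hsplitA]; exact hasMaj_add_exp hb hEd
  have h0 := hasMaj_id_ofBlocks (g := unitTorusGeo L kk M) (blkFine L kk M) (unitTorusGeo_dist_self (L := L) (k := kk) (M := M)) ρ₀
  have hline : ∀ κ : Fin (d + 1), HasMaj (BlockNorm.ofBlocks (unitTorusGeo L kk M) (blkFine L kk M)) (BlockNorm.ofBlocks (unitTorusGeo L kk M) (blkFine L kk M))
      ((((L ^ kk : ℕ) : ℝ)⁻¹ • symbOp M (L ^ kk) (sD M (L ^ kk) κ ((L ^ kk : ℕ) : ℝ))) ∘ₗ (symbOp M (L ^ kk) (sA M (L ^ kk) κ (L ^ kk)) ∘ₗ LinearMap.id))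
      (fun y y' => 2 * Real.exp ρ₀ / ((L ^ kk : ℕ) : ℝ) * 1 * Real.exp (-(ρ₀ * tdistT M y y'))) := fun κ =>
    hasMaj_lineDiff_comp M kk (L ^ kk) zero_le_one hρ₀.le κ h0
  have h99 := hasMaj_qvRe_pull_sub_comp_of_line M kk r (B := 2 * Real.exp ρ₀ / ((L ^ kk : ℕ) : ℝ) * 1) (by positivity) hline
  rw [LinearMap.comp_id] at h99
  have hc := hasMaj_tensorId ι (fun y y' => by positivity) h99
  rw [tensorId_sub, ← tensorId_comp_tensorId, tensorId_pull] at hc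
  have hQUd : HasMaj (CvNorm d L mv kk hL ι) (BlockNorm.ofBlocks (unitTorusGeo L kk M) (liftBlk (fun b : Tor M × Fin (d + 1) => b.1) ι))
      ((tensorId ι (qvRe M (L ^ r * L ^ kk)) + D') ∘ₗ pull (liftMap (kingPrV L kk r M) ι) - (tensorId ι (qvRe M (L ^ kk)) + D))
      (fun y y' => (2 * Real.exp ρ₀ / ((L ^ kk : ℕ) : ℝ) * 1 + τD) * Real.exp (-(ρ₀ * tdistT M y y'))) := by
    have hsplitQ : (tensorId ι (qvRe M (L ^ r * L ^ kk)) + D') ∘ₗ pull (liftMap (kingPrV L kk r M) ι) - (tensorId ι (qvRe M (L ^ kk)) + D) =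
        (tensorId ι (qvRe M (L ^ r * L ^ kk)) ∘ₗ pull (liftMap (kingPrV L kk r M) ι) - tensorId ι (qvRe M (L ^ kk))) + (D' ∘ₗ pull (liftMap (kingPrV L kk r M) ι) - D) := by
      rw [LinearMap.add_comp]; abel
    rw [hsplitQ]; exact hasMaj_add_exp hc hDd
  -- nonnegativity of the sizes
  have hq1 : (0 : ℝ) ≤ 1 * Real.exp ρ₀ := by positivity
  have hq2 : (0 : ℝ) ≤ 1 * Real.exp ρ₀ + ρE := by positivity
  have hτT : 0 ≤ |DI| * ((((L ^ kk : ℕ) : ℝ)) ^ (-(1 / 16 : ℝ)) + R₁ * basisConst e * rA * ((((L ^ kk : ℕ) : ℝ))⁻¹)) := by positivity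
  have hτA : (0 : ℝ) ≤ 2 * Real.exp ρ₀ / (L : ℝ) ^ kk * 1 + τE := by positivity
  have hτQ : (0 : ℝ) ≤ 2 * Real.exp ρ₀ / ((L ^ kk : ℕ) : ℝ) * 1 + τD := by positivity
  have hτQ' : (0 : ℝ) ≤ 2 * Real.exp ρ₀ / ((L ^ kk : ℕ) : ℝ) * 1 := by positivity
  -- the four sandwich letters and the two η-difference letters ((Q-1))
  have hS2c := hasMaj_sandwich_exp_ofBlocks htri hd hρ₀.le hc₂0.le hrow₂ hrow₄ hρD hBX.le hq2 hDc hXc₀ hAUc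
  have hS2f := hasMaj_sandwich_exp_ofBlocks htri hd hρ₀.le hc₂0.le hrow₂ hrow₄ hρD hBX.le hq2 hDf hXf₀ hAUf
  have hS3c := hasMaj_sandwich_exp_ofBlocks htri hd hρ₀.le hc₂0.le hrow₂ hrow₄ hq1 hBX.le hρE hQc hXc₀ hEc
  have hS3f := hasMaj_sandwich_exp_ofBlocks htri hd hρ₀.le hc₂0.le hrow₂ hrow₄ hq1 hBX.le hρE hQf hXf₀ hEf
  have hS2d := hasMaj_sandwich_sub_exp_ofBlocks htri hd hρ₀.le hc₂0.le hrow₂ hrow₄ hρD hBX.le hq2 hτT hτA hτD hDf hXf₀ hXc₀ hAUc hXI' hAUd hDd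
  have hS3d := hasMaj_sandwich_sub_exp_ofBlocks htri hd hρ₀.le hc₂0.le hrow₂ hrow₄ hq1 hBX.le hρE hτT hτE hτQ' hQf hXf₀ hXc₀ hEc hXI' hEd hc
  -- read as coloured entry letters ((J-a) §2), all at the common rate `δ = min δ_Z (ρ₀∕4)`
  set θ : ℝ := (((L ^ kk : ℕ) : ℝ)) ^ (-(1 / 16 : ℝ)) with hθ
  set η : ℝ := ((((L ^ kk : ℕ) : ℝ))⁻¹) with hη
  have hcc0 : 0 ≤ c₂ * c₄ := by positivity
  have hU := fun (T : ((Tor M × Fin (d + 1)) × ι → ℝ) →ₗ[ℝ] ((Tor M × Fin (d + 1)) × ι → ℝ)) {B : ℝ} (hB : 0 ≤ B)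
      (h : HasMaj (BlockNorm.ofBlocks (unitTorusGeo L kk M) (liftBlk (fun bb : Tor M × Fin (d + 1) => bb.1) ι))
        (BlockNorm.ofBlocks (unitTorusGeo L kk M) (liftBlk (fun bb : Tor M × Fin (d + 1) => bb.1) ι)) T (fun y y' => B * Real.exp (-(ρ₀ / 4 * tdistT M y y'))))
      (p q : B4.Idx (pbox M) (d + 1) × ι) =>
    (abs_unitBondMatC_le_of_hasMaj M kk ι (δ := ρ₀ / 4) hB h p q).trans (exp_decay_mono hB (min_le_right δZ (ρ₀ / 4)) (cdist_nonneg M ι p q))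
  refine ⟨fun p q => ?_, fun p q => ?_, fun p q => ?_⟩
  · -- (i)
    have hρpq := cdist_nonneg M ι p q
    have hE := Real.exp_nonneg (-(min δZ (ρ₀ / 4) * cdist M ι p q))
    have hKe : KZ + c₂ * c₄ * ((6 * Real.exp ρ₀ + 2) * BX + (2 * Real.exp ρ₀ + 1) * |DI| * (1 + R₁)) ≤ K := by rw [hK]; exact (lt_add_one _).le
    have hamp := amp_size_le (KZ := KZ) (κr := basisConst e * rA) (ρD := ρD) (e₀ := Real.exp ρ₀) (c := c₂ * c₄) hKZ.le (by positivity) hρD hρE hρE1 hBX.le he₀0.le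
      (abs_nonneg DI) hR₁0.le hcc0 hKe
    have e1 := (hZ1 p q).trans (exp_decay_mono (by positivity) (min_le_left δZ (ρ₀ / 4)) hρpq)
    have e2 := hU _ (B := ρD * BX * (1 * Real.exp ρ₀ + ρE) * c₂ * c₄) (by positivity) hS2c p q
    have e3 := hU _ (B := 1 * Real.exp ρ₀ * BX * ρE * c₂ * c₄) (by positivity) hS3c p q
    rw [zCovC, Matrix.add_apply, Matrix.add_apply]
    refine (abs_add_three _ _ _).trans ((add_le_add (add_le_add e1 e2) e3).trans ?_)
    clear e1 e2 e3
    linarith [mul_le_mul_of_nonneg_right hamp hE]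
  · -- (ii)
    have hρpq := cdist_nonneg M ι p q
    have hE := Real.exp_nonneg (-(min δZ (ρ₀ / 4) * cdist M ι p q))
    have hKe : KZ + c₂ * c₄ * ((6 * Real.exp ρ₀ + 2) * BX + (2 * Real.exp ρ₀ + 1) * |DI| * (1 + R₁)) ≤ K := by rw [hK]; exact (lt_add_one _).le
    have hamp := amp_size_le (KZ := KZ) (κr := basisConst e * rA) (ρD := ρD) (e₀ := Real.exp ρ₀) (c := c₂ * c₄) hKZ.le (by positivity) hρD hρE hρE1 hBX.le he₀0.le
      (abs_nonneg DI) hR₁0.le hcc0 hKe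
    have e1 := (hZ2 p q).trans (exp_decay_mono (by positivity) (min_le_left δZ (ρ₀ / 4)) hρpq)
    have e2 := hU _ (B := ρD * BX * (1 * Real.exp ρ₀ + ρE) * c₂ * c₄) (by positivity) hS2f p q
    have e3 := hU _ (B := 1 * Real.exp ρ₀ * BX * ρE * c₂ * c₄) (by positivity) hS3f p q
    rw [zCovF, Matrix.add_apply, Matrix.add_apply]
    refine (abs_add_three _ _ _).trans ((add_le_add (add_le_add e1 e2) e3).trans ?_)
    clear e1 e2 e3
    linarith [mul_le_mul_of_nonneg_right hamp hE]
  · -- (iii)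
    have hρpq := cdist_nonneg M ι p q
    have hE := Real.exp_nonneg (-(min δZ (ρ₀ / 4) * cdist M ι p q))
    -- amplitudes against `K·(θ + κ_e r_A η + τ_D + τ_E)` (§2a)
    have hKe : KZ + c₂ * c₄ * ((6 * Real.exp ρ₀ + 2) * BX + (2 * Real.exp ρ₀ + 1) * |DI| * (1 + R₁)) ≤ K := by rw [hK]; exact (lt_add_one _).le
    have hamp := amp_defect_le (KZ := KZ) (θ := θ) (κη := basisConst e * rA * η) (η := η) (τD := τD) (τE := τE) (e₀ := Real.exp ρ₀) (A := |DI|) (R₁ := R₁) (c := c₂ * c₄)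
      hKZ.le hθ0 (by positivity) hη0 hηθ hτD hτE hρD1 hρE hρE1 hBX.le he₀0.le (abs_nonneg DI) hR₁0.le hcc0 hKe
    have hdiv1 : 2 * Real.exp ρ₀ / (L : ℝ) ^ kk * 1 = 2 * Real.exp ρ₀ * η := by rw [hcast, div_eq_mul_inv, mul_one]
    have hdiv2 : 2 * Real.exp ρ₀ / ((L ^ kk : ℕ) : ℝ) * 1 = 2 * Real.exp ρ₀ * η := by rw [div_eq_mul_inv, mul_one]
    have hsplit : zCovF d mm ι a e hL mv kk r A' D' E' p q - zCovC d mm ι a e hL mv kk r A' D E p q =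
        (zLiveF d mm ι a e hL mv kk r A' p q - zLiveC d mm ι a e hL mv kk r A' p q) +
        (unitBondMatC M ι (D' ∘ₗ cvGlued' d L mv kk r hL a ((((L ^ r * L ^ kk : ℕ) : ℝ))⁻¹) ι e (fun _ _ => (1 : Matrix mm mm ℂ))
              (fun μ x' => NormedSpace.exp (((((L ^ r * L ^ kk : ℕ) : ℝ))⁻¹) • A' μ x')) (cvNL' d L mv kk r hL a ι) (fun _ => 0) ∘ₗ (tensorId ι (qvAdjRe M (L ^ r * L ^ kk)) + E') -
            D ∘ₗ cvGlued d L mv kk hL a ((((L ^ kk : ℕ) : ℝ))⁻¹) ι e (fun _ _ => (1 : Matrix mm mm ℂ))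
              (fun μ x => NormedSpace.exp (((((L ^ kk : ℕ) : ℝ))⁻¹) • gavgM (Matrix mm mm ℂ) (Fin (d + 1)) (kingPrV L kk r M) A' μ x)) (cvNL d L mv kk hL a ι) (fun _ => 0) ∘ₗ
              (tensorId ι (qvAdjRe M (L ^ kk)) + E)) p q) +
        (unitBondMatC M ι (tensorId ι (qvRe M (L ^ r * L ^ kk)) ∘ₗ cvGlued' d L mv kk r hL a ((((L ^ r * L ^ kk : ℕ) : ℝ))⁻¹) ι e (fun _ _ => (1 : Matrix mm mm ℂ))
              (fun μ x' => NormedSpace.exp (((((L ^ r * L ^ kk : ℕ) : ℝ))⁻¹) • A' μ x')) (cvNL' d L mv kk r hL a ι) (fun _ => 0) ∘ₗ E' -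
            tensorId ι (qvRe M (L ^ kk)) ∘ₗ cvGlued d L mv kk hL a ((((L ^ kk : ℕ) : ℝ))⁻¹) ι e (fun _ _ => (1 : Matrix mm mm ℂ))
              (fun μ x => NormedSpace.exp (((((L ^ kk : ℕ) : ℝ))⁻¹) • gavgM (Matrix mm mm ℂ) (Fin (d + 1)) (kingPrV L kk r M) A' μ x)) (cvNL d L mv kk hL a ι) (fun _ => 0) ∘ₗ E) p q) := by
      rw [zCovF, zCovC, unitBondMatC_sub, unitBondMatC_sub]
      simp only [Matrix.add_apply, Matrix.sub_apply]
      abel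
    have e1 := (hZ3 p q).trans (exp_decay_mono (by positivity) (min_le_left δZ (ρ₀ / 4)) hρpq)
    have e2 := hU _ (B := c₂ * c₄ * (ρD * BX * (2 * Real.exp ρ₀ / (L : ℝ) ^ kk * 1 + τE) + ρD * (1 * Real.exp ρ₀ + ρE) * (|DI| * (θ + R₁ * basisConst e * rA * η)) +
      BX * (1 * Real.exp ρ₀ + ρE) * τD)) (by positivity) hS2d p q
    have e3 := hU _ (B := c₂ * c₄ * (1 * Real.exp ρ₀ * BX * τE + 1 * Real.exp ρ₀ * ρE * (|DI| * (θ + R₁ * basisConst e * rA * η)) + BX * ρE * (2 * Real.exp ρ₀ / ((L ^ kk : ℕ) : ℝ) * 1)))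
      (by positivity) hS3d p q
    rw [hsplit]
    refine (abs_add_three _ _ _).trans ((add_le_add (add_le_add e1 e2) e3).trans ?_)
    clear e1 e2 e3 hsplit
    rw [hdiv1, hdiv2]
    linarith [mul_le_mul_of_nonneg_right hamp hE]

end Summit.QuantumFields.YangMills.BalabanUVNodes.N15.GluedZeroField
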